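import Summits.ResolutionOfSingularities.ResolutionOfSingularities.Theorems.FrobeniusLadderFInjectiveMacaulayficationFullWeightBudget
import Mathlib.Algebra.CharP.Lemmas
import HarnessLib

/-!
# K9 — THE SQUARE BUDGET: a Fedder survivor bounds the weighted distance of `f` from the square-cubics `h²·l`

[OURS · L1 W4.5a · res-L1-w45a-lead-1 g15 · kernel brick K9 for crux `FInjectiveMacaulayfication` stmt-ResolutionOfSingularities-15315,
companion of `Cruxes/FInjectiveMacaulayfication/Lines/T-disc.md` rev 17 §0.22 (the SECTION SQUARE BUDGET) and of §0.2/§0.20 (the drop-point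
budget is its case `h = x̃`, `l = 1`); supports the crux, proves nothing of it; OURS counted 0; AI-written (AI review is weaker than expert review).]

THE STATEMENT (★★ `square_budget`). Let `A` be a commutative ring of prime characteristic `p ≥ 3`, `w : Fin m → ℕ` a weight vector, and
`f = h²·l + g ∈ A[y₁,…,y_m]` with `h` WITHOUT CONSTANT TERM, every monomial of `h²·l` of `w`-weight `≥ w_S` and every monomial of `g` of
`w`-weight `≥ w_g ≥ w_S`. If `f^{p−1} ∉ (y₁^p, …, y_m^p)` (a Fedder SURVIVOR: F-purity of the hypersurface `f = 0` at the origin) then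
**`w_S + w_g ≤ 2·Σᵢ wᵢ`** — the defect `g` of `f` from the square-cubic `h²l` cannot start later than weight `2|w| − w_S`.
Proof: `h^p ∈ (yᵢ^p)` (Frobenius: `h^p = Σ_m c_m^p y^{p·m}` and every `m ≠ 0`); in `f^{p−1} = Σ_i binom·(h²l)^{p−1−i}g^i` the terms with
`2(p−1−i) ≥ p` are multiples of `h^p`, the others (`i ≥ (p−1)/2`) have all monomials of weight `≥ ((p−1)/2)(w_S + w_g) > (p−1)|w|`, hence an
exponent `≥ p` somewhere (K4 `weight_le_of_forall_lt`) — so `f^{p−1} ∈ (yᵢ^p)`, contradiction.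
SPECIAL CASES: `h = y₀`, `l = 1`, `w ≡ 1` on `m+1` letters: the DOUBLE-POINT budget `ord a ≤ 2m` (K4 `order_le_two_mul_of_survivor`); `g = 0`:
an exact square-cubic is never F-pure (TC-β ✓p717528 `X_mul_pow_mem_of_restrict_eq_mul_sq` is the restriction form); `w = W_C` the weight of a
permissible section `C` with `in_{W_C} f = (x−φ)²(x−ψ)`: `W_C(f − (x−φ)²(x−ψ)) ≤ 2|W_C| − 3w_x` (T-disc §0.22).
No named fact; exponent bookkeeping + Frobenius additivity in characteristic `p`.
-/

-- single-problem summit: the doubled namespace component is forced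
set_option linter.dupNamespace false

noncomputable section

open MvPolynomial Finsupp

namespace Summit.ResolutionOfSingularities.ResolutionOfSingularities.Theorems.FInjectiveMacaulayfication.FullSquareBudget

variable {A : Type} [CommRing A] {m : ℕ}

/-- A polynomial each of whose monomials has SOME exponent `≥ p` lies in `(y₁^p, …, y_m^p)` (contrapositive of K3
`FullNoKangaroo.exists_support_lt_of_not_mem`). [plumbing] -/
theorem mem_frobPow_of_support (p : ℕ) (φ : MvPolynomial (Fin m) A)
    (h : ∀ d ∈ φ.support, ∃ i, p ≤ d i) : φ ∈ Ideal.span (Set.range fun i : Fin m => (X i : MvPolynomial (Fin m) A) ^ p) := by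
  by_contra hφ
  obtain ⟨d, hd, hlt⟩ := FullNoKangaroo.exists_support_lt_of_not_mem p φ hφ
  obtain ⟨i, hi⟩ := h d hd
  exact absurd (hlt i) (not_lt.mpr hi)

/-- A polynomial each of whose monomials has `w`-weight `> (p−1)·Σ wᵢ` lies in `(y₁^p, …, y_m^p)`: a monomial with all exponents `≤ p − 1` has
weight `≤ (p−1)·Σ wᵢ` (K4 `weight_le_of_forall_lt`). [plumbing] -/
theorem mem_frobPow_of_weight_gt (p : ℕ) (w : Fin m → ℕ) (φ : MvPolynomial (Fin m) A)
    (h : ∀ d ∈ φ.support, (p - 1) * ∑ i, w i < weight w d) : φ ∈ Ideal.span (Set.range fun i : Fin m => (X i : MvPolynomial (Fin m) A) ^ p) := by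
  refine mem_frobPow_of_support p φ fun d hd => ?_
  by_contra! hall
  exact absurd (FullWeightBudget.weight_le_of_forall_lt w p d hall) (not_le.mpr (h d hd))

/-- Monomials of a product have weight ≥ the sum of lower bounds for the factors. [plumbing] -/
theorem le_weight_of_mem_support_mul (w : Fin m → ℕ) (φ ψ : MvPolynomial (Fin m) A) (a b : ℕ)
    (hφ : ∀ d ∈ φ.support, a ≤ weight w d) (hψ : ∀ d ∈ ψ.support, b ≤ weight w d) :
    ∀ e ∈ (φ * ψ).support, a + b ≤ weight w e := by
  intro e he
  obtain ⟨u, hu, v, hv, rfl⟩ := Finset.mem_add.mp (support_mul _ _ he)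
  rw [map_add]
  exact add_le_add (hφ u hu) (hψ v hv)

/-- In characteristic `p` (prime), a polynomial WITHOUT CONSTANT TERM has its `p`-th power in `(y₁^p, …, y_m^p)`:
`h^p = Σ_m c_m^p · y^{p·m}` by Frobenius additivity, and `p·m ≥ p·e_i` for some `i` since `m ≠ 0`. [OURS, plumbing] -/
theorem pow_char_mem_frobPow (p : ℕ) (hp : p.Prime) [CharP A p] (h : MvPolynomial (Fin m) A)
    (h0 : coeff 0 h = 0) : h ^ p ∈ Ideal.span (Set.range fun i : Fin m => (X i : MvPolynomial (Fin m) A) ^ p) := by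
  haveI : Fact p.Prime := ⟨hp⟩
  haveI : ExpChar (MvPolynomial (Fin m) A) p := ExpChar.prime hp
  rw [h.as_sum, sum_pow_char]
  refine Ideal.sum_mem _ fun v hv => ?_
  rw [monomial_pow]
  -- v ≠ 0 since the constant coefficient vanishes
  have hv0 : v ≠ 0 := by
    rintro rfl
    exact (MvPolynomial.mem_support_iff.mp hv) h0
  obtain ⟨i, hi⟩ : ∃ i, v i ≠ 0 := by
    by_contra! hall
    exact hv0 (Finsupp.ext fun i => by simpa using hall i)
  refine mem_frobPow_of_support p _ fun d hd => ⟨i, ?_⟩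
  -- the only monomial of `monomial (p • v) c` is `p • v`
  classical
  rw [support_monomial] at hd
  split_ifs at hd with hc
  · simp at hd
  · rw [Finset.mem_singleton] at hd
    subst hd
    rw [Finsupp.smul_apply, smul_eq_mul]
    exact Nat.le_mul_of_pos_right p (Nat.pos_of_ne_zero hi)

/-- ★★ **THE SQUARE BUDGET.** `A` of prime characteristic `p ≥ 3`; `f = h²·l + g` with `coeff 0 h = 0`, every monomial of `h²·l` of `w`-weight
`≥ w_S`, every monomial of `g` of `w`-weight `≥ w_g`, `w_S ≤ w_g`; if `f^{p−1} ∉ (y₁^p,…,y_m^p)` (Fedder survivor) then `w_S + w_g ≤ 2·Σᵢ wᵢ`.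
[OURS] -/
theorem square_budget (p : ℕ) (hp : p.Prime) (hp3 : 3 ≤ p) [CharP A p] (w : Fin m → ℕ)
    (h l g : MvPolynomial (Fin m) A) (h0 : coeff 0 h = 0) (wS wg : ℕ) (hSg : wS ≤ wg)
    (hS : ∀ d ∈ (h ^ 2 * l).support, wS ≤ weight w d) (hg : ∀ d ∈ g.support, wg ≤ weight w d)
    (hF : (h ^ 2 * l + g) ^ (p - 1) ∉ Ideal.span (Set.range fun i : Fin m => (X i : MvPolynomial (Fin m) A) ^ p)) :
    wS + wg ≤ 2 * ∑ i, w i := by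
  by_contra! hlt
  apply hF
  -- p − 1 = 2k with k ≥ 1
  obtain ⟨k, hk⟩ : ∃ k, p - 1 = 2 * k := by
    obtain ⟨k, hk⟩ := hp.odd_of_ne_two (by omega)
    exact ⟨k, by omega⟩
  rw [add_pow, hk]
  refine Ideal.sum_mem _ fun i hi => ?_
  rw [Finset.mem_range] at hi
  -- term: (h²l)^i * g^(2k − i) * choose
  refine Ideal.mul_mem_right _ _ ?_
  rcases le_or_gt (k + 1) i with hbig | hsmall
  · -- many copies of h: (h²l)^i = h^(2i) l^i with 2i ≥ 2k+2 ≥ p+1 > p ⇒ multiple of h^p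
    have hmem : h ^ p ∈ Ideal.span (Set.range fun i : Fin m => (X i : MvPolynomial (Fin m) A) ^ p) := pow_char_mem_frobPow p hp h h0
    have hdiv : h ^ p ∣ (h ^ 2 * l) ^ i * g ^ (2 * k - i) := by
      refine Dvd.dvd.mul_right ?_ _
      rw [mul_pow, ← pow_mul]
      exact Dvd.dvd.mul_right (pow_dvd_pow h (by omega)) _
    obtain ⟨q, hq⟩ := hdiv
    rw [hq]
    exact Ideal.mul_mem_right _ _ hmem
  · -- i ≤ k: weight of every monomial ≥ i·wS + (2k−i)·wg ≥ k (wS + wg) > (p−1)|w|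
    refine mem_frobPow_of_weight_gt p w _ fun d hd => ?_
    have hwt : i * wS + (2 * k - i) * wg ≤ weight w d := by
      refine le_weight_of_mem_support_mul w _ _ _ _ ?_ ?_ d hd
      · exact FullWeightBudget.le_weight_of_mem_support_pow w _ wS hS i
      · exact FullWeightBudget.le_weight_of_mem_support_pow w _ wg hg (2 * k - i)
    have hk1 : k * (wS + wg) ≤ i * wS + (2 * k - i) * wg := by
      -- (2k − i) wg = k wg + (k − i) wg ≥ k wg + (k − i) wS, and i wS + (k−i) wS = k wS
      have h1 : (2 * k - i) * wg = k * wg + (k - i) * wg := by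
        rw [← add_mul]; congr 1; omega
      have h2 : (k - i) * wS ≤ (k - i) * wg := Nat.mul_le_mul_left _ hSg
      have h3 : i * wS + (k - i) * wS = k * wS := by rw [← add_mul]; congr 1; omega
      nlinarith
    have : (p - 1) * ∑ j, w j < k * (wS + wg) := by
      rw [hk]
      have : 2 * ∑ j, w j < wS + wg := hlt
      calc 2 * k * ∑ j, w j = k * (2 * ∑ j, w j) := by ring
        _ < k * (wS + wg) := Nat.mul_lt_mul_of_pos_left this (by omega)
    omega

/-- ★ COROLLARY (exact square-cubics are never F-pure, every weight being irrelevant): if `f = h²·l` with `coeff 0 h = 0` then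
`f^{p−1} ∈ (y₁^p, …, y_m^p)` for every prime `p ≥ 3` — the polynomial form of TC-β's «exact cancellation ⇒ never FULL». [OURS] -/
theorem sq_mul_pow_mem_frobPow (p : ℕ) (hp : p.Prime) (hp3 : 3 ≤ p) [CharP A p]
    (h l : MvPolynomial (Fin m) A) (h0 : coeff 0 h = 0) :
    (h ^ 2 * l) ^ (p - 1) ∈ Ideal.span (Set.range fun i : Fin m => (X i : MvPolynomial (Fin m) A) ^ p) := by
  by_contra hF
  -- apply the budget with g = 0 and absurd weights: w ≡ 0, wS = 0, wg = 1
  have := square_budget p hp hp3 (fun _ => 0) h l 0 h0 0 1 (by omega) (fun d _ => Nat.zero_le _)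
    (fun d hd => by simp at hd) (by simpa using hF)
  simp at this

end Summit.ResolutionOfSingularities.ResolutionOfSingularities.Theorems.FInjectiveMacaulayfication.FullSquareBudget

end
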